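import Literature.AlgebraicGeometry.Frobenioids.PadicKummerLocalField
import Literature.NumberTheory.GaloisRepresentations.GaloisCohomologyKummerProofs
import Mathlib.FieldTheory.Galois.Infinite
import HarnessLib

/-!
# Frobenioids II, Remark 2.2.1: `N`-th roots of `H`-invariants, at the arithmetic binding

Mochizuki, *The geometry of Frobenioids II*, Kyushu J. Math. **62** (2008) 401–460, §2, Remark 2.2.1
p. 18 [cite: MochizukiFrdII2008, Rmk 2.2.1 p.18]: "the [first cohomology module portion of the]
Galois-theoretic condition of Definition 2.2, (ii), (c), implies [upon translation into 'extension
field-theoretic language'] that any element `f ∈ O^□(A)^H` admits an `N`-th root `g ∈ O^□(A)` —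
i.e., `g^N = f`. Thus, the Kummer map [cf. Definition 2.1, (ii)] is defined on all of `O^□(A)^H`."

`KummerReciprocity.lean` records this as the property `Kummer.InvariantsAdmitRoots` and
`PadicKummerSetting.lean` as the named fact `SaturatedInvariantsAdmitRoots X N :=
IsNHSaturated X N → InvariantsAdmitRoots N X.O X.HA` (abc-iut-L1-t7). This file PROVES it at the
arithmetic context `Def22Context.ofLocalField L H hH S` (`PadicKummerLocalField.lean`: `K` a field
of characteristic `0`, `L ⊆ K̄` finite Galois, `H ⊆ G_K` open normal, `O^□(A) = O^□_L` a
`Gal(L/K)`-stable submonoid of `L` closed under `N`-th roots — e.g. `O^⊳_L`, `O^×_L`) in the case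
`Gal(K̄/L) ≤ H` (i.e. `L ⊇ K̄^H`, so that `H ↠ H_A = Gal(L/K̄^H)` has kernel `Gal(K̄/L)`; this is
the situation produced by the pull-backs of Remark 2.2.1, `L` large), by the printed "extension
field-theoretic" argument made cocycle-level:
* `Kummer.apply_eq_zero_of_mem_range_infl` (any context): a continuous crossed homomorphism of `H`
  whose class is inflated from `H_A` vanishes on `Ker(H ↠ H_A)`;
* `kummerCocycleOn` — the Kummer cocycle `σ ↦ σ(α)/α` of `H` with values in `μ_N(K̄)` for `α` with
  `α^N` fixed by `H` (the tree's `kummerOneCocycle`, restricted to the subgroup `H`);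
* `smul_eq_of_isNHSaturated` — under condition (c) (surjectivity on `H¹(−, μ_N(A))`, transported
  to `μ_N(K̄)`-coefficients by `muCoeffIso`), every such `α` is fixed by `Ker(H ↠ H_A)`;
* `invariantField`, `submonoidOfInvariantField`, `invariantsEquiv` — the remark's "natural
  isomorphism `O^□(A)^H ⥲ O^□(L^H)`" at the arithmetic context (identity on elements of `L`),
  with `O^⊳(L^H) = nonzeroIntegers K (L^H)` (`mem_submonoidOfInvariantField_tri_iff`);
* `coe_rootsOfUnity_mem_of_isMuSaturated` — (a) "`μ_N`-saturated" ⇒ `μ_N(K̄) ⊆ L` (counting);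
* `saturatedInvariantsAdmitRoots_ofLocalField` — **`SaturatedInvariantsAdmitRoots` DISCHARGED** at
  `ofLocalField` when `Gal(K̄/L) ≤ H`: `α ∈ K̄^{Gal(K̄/L)} = L` (infinite Galois correspondence,
  `K` of characteristic `0`) and `α ∈ O^□_L` by root-closure.
Scope note (neutral): for `Gal(K̄/L) ⊄ H` the printed claim additionally needs the
`H¹(−, ℤ/Nℤ)`-clause of (c) and a Galois-descent step from the compositum `K̄^H · L` down to `L`;
that case is not treated here. Nothing here concerns [IUTchIII]. Universe `0`.
-/

noncomputable section

namespace Literature.AlgebraicGeometry.Frobenioids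

open Field IntermediateField CategoryTheory
open scoped ValuativeRel
open Literature.NumberTheory.GaloisRepresentations
open Literature.NumberTheory.GaloisRepresentations.LocalWeilDatum
open Literature.NumberTheory.GaloisRepresentations.DiscreteGaloisModule

/-! ### Inflated classes vanish on the kernel (any context) -/

namespace Kummer

/-- A continuous crossed homomorphism `c : H → X` (for `H` acting on `X` through `q : H → H_A`)
whose class in `H¹(H, X)` is inflated from `H¹(H_A, X)` vanishes on `Ker q`: writing
`[c] = infl [ψ]`, `c - ψ ∘ q` is principal, `σ ↦ σ·v - v`, and both `ψ (q σ)` and `σ·v - v`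
vanish for `q σ = 1`. (The "extension field-theoretic" translation step of FrdII Rmk. 2.2.1.)
The topology instances on `Γ` are implicit (not instance) binders so that they are read off the
type of `q` — see the note on topologies in `PadicKummerGaloisFN.lean`.
[cite: MochizukiFrdII2008, Rmk 2.2.1 p.18] -/
theorem apply_eq_zero_of_mem_range_infl {Γ : Type} [Group Γ] {_ : TopologicalSpace Γ}
    {_ : DiscreteTopology Γ} (HA : Subgroup Γ) {H : Type} [Group H] [TopologicalSpace H]
    [IsTopologicalGroup H] (q : H →ₜ* HA) (X : TopRep ℤ HA)
    (c : contOneCocycles (TopRep.res (q : H →* HA) X))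
    (hc : oneCocycleClass _ c ∈ Set.range (infl HA q X 1).hom) {σ : H} (hσ : q σ = 1) :
    c.1 σ = 0 := by
  obtain ⟨y, hy⟩ := hc
  obtain ⟨ψ, rfl⟩ := oneCocycleClass_surjective X y
  have hmap : (infl HA q X 1).hom (oneCocycleClass X ψ) =
      oneCocycleClass _ (contOneCocycles.pullback q (𝟙 (TopRep.res (q : H →* HA) X)) ψ) :=
    map_oneCocycleClass X q (𝟙 _) ψ
  rw [hmap] at hy
  have h0 : oneCocycleClass _ (c - contOneCocycles.pullback q (𝟙 (TopRep.res (q : H →* HA) X)) ψ) =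
      0 := by
    rw [oneCocycleClass_sub, ← hy, sub_self]
  obtain ⟨v, hv⟩ := (oneCocycleClass_eq_zero_iff _ _).mp h0
  have h1 := hv σ
  rw [Submodule.coe_sub, ContinuousMap.sub_apply, contOneCocycles.pullback_apply, hσ,
    contOneCocycles.apply_one, TopRep.id_apply, sub_zero] at h1
  rw [h1]
  change X.ρ (q σ) v - v = 0
  rw [hσ, map_one]
  exact sub_self _

end Kummer

namespace PadicKummer

namespace Def22Context

/-- The same for a Definition 2.2 context `X` and condition (c): under `(N, H)`-saturation, a
continuous crossed homomorphism `H → μ_N(A)` (action through `H ↠ H_A`) vanishes on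
`Ker(H ↠ H_A)`. Stated for an ABSTRACT `X`, so that the instances are those of the interface.
[cite: MochizukiFrdII2008, Rmk 2.2.1 p.18] -/
theorem oneCocycle_apply_eq_zero_of_isNHSaturated (X : Def22Context) (N : ℕ)
    (h : IsNHSaturated X N)
    (c : contOneCocycles (TopRep.res (X.qHA : X.H →* X.HA) (Kummer.muTopRep N X.O X.HA)))
    {σ : X.H} (hσ : X.qHA σ = 1) : c.1 σ = 0 :=
  Kummer.apply_eq_zero_of_mem_range_infl X.HA X.qHA _ c (h.cohSaturated.bijective_one_mu.2 _) hσ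

/-! ### The Kummer cocycle of `H` with values in `μ_N(K̄)` -/

section Cocycle

variable {K : Type} [Field K] (H : Subgroup (absoluteGaloisGroup K)) (N : ℕ)

/-- The Kummer cocycle `σ ↦ σ(α)/α ∈ μ_N(K̄)` on the subgroup `H ≤ G_K`, for a unit `α` of `K̄`
whose `N`-th power is fixed by `H` ("any element `f ∈ O^□(A)^H` … `g^N = f`": `α` is an `N`-th root
of `f` in `K̄`); a continuous crossed homomorphism for the module `μ_N(K̄)|_H`.
[cite: MochizukiFrdII2008, Rmk 2.2.1 p.18] -/
def kummerCocycleOn (α : (AlgebraicClosure K)ˣ)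
    (hα : ∀ σ : absoluteGaloisGroup K, σ ∈ H → σ • α ^ N = α ^ N) :
    contOneCocycles ((mu K N).restrict (subgroupIncl H)).toTopRep := by
  refine ⟨⟨fun σ : H => MuCarrier.ofRootsOfUnity
      ⟨(σ : absoluteGaloisGroup K) • α / α, ?_⟩, ?_⟩, ?_⟩
  · rw [mem_rootsOfUnity, div_pow, ← smul_pow', hα σ σ.2, div_self']
  · refine (IsLocallyConstant.desc _ (muVal K N) ?_ (muVal_injective K N)).continuous
    have h1 : IsLocallyConstant fun σ : H => (σ : absoluteGaloisGroup K) • α :=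
      (isLocallyConstant_smul_units K α).comp_continuous continuous_subtype_val
    exact h1.div (IsLocallyConstant.const _)
  · intro σ τ
    apply muVal_injective K N
    have hρ : ∀ v : MuCarrier K N,
        muVal K N ((((mu K N).restrict (subgroupIncl H)).toTopRep).ρ σ v) =
          (σ : absoluteGaloisGroup K) • muVal K N v := fun v => rfl
    rw [muVal_add, hρ]
    simp only [ContinuousMap.coe_mk, muVal_ofRootsOfUnity]
    rw [Subgroup.coe_mul, mul_smul, smul_div', mul_comm, div_mul_div_cancel]

/-- The Kummer cocycle on elements (down to `K̄ˣ`). [cite: MochizukiFrdII2008, Rmk 2.2.1 p.18] -/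
@[simp] theorem muVal_kummerCocycleOn (α : (AlgebraicClosure K)ˣ)
    (hα : ∀ σ : absoluteGaloisGroup K, σ ∈ H → σ • α ^ N = α ^ N) (σ : H) :
    muVal K N ((kummerCocycleOn H N α hα).1 σ) = (σ : absoluteGaloisGroup K) • α / α :=
  rfl

end Cocycle

/-! ### Condition (c) forces `Ker(H ↠ H_A)` to fix the `N`-th roots -/

section Fixed

variable {K : Type} [Field K] (L : IntermediateField K (AlgebraicClosure K)) [Normal K L]
  [FiniteDimensional K L]
  (H : Subgroup (absoluteGaloisGroup K)) [H.Normal] (hH : IsOpen (H : Set (absoluteGaloisGroup K)))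
  {AutC : Type} (O : Type) [Group AutC] [CommMonoid O] [IsCancelMul O] [MulDistribMulAction AutC O]
  [MulDistribMulAction (L ≃ₐ[K] L) O] (res : AutC →* (L ≃ₐ[K] L))
  (res_smul : ∀ (α : AutC) (x : O), res α • x = α • x) {N : ℕ}

/-- **Remark 2.2.1, the Galois-cohomological step** (FrdII p. 18): at the Galois binding, if the
map `H¹(H_A, μ_N(A)) → H¹(H, μ_N(A))` of Def. 2.2 (ii)(c) is surjective, then for every unit `α` of
`K̄` with `α^N` fixed by `H`, `α` itself is fixed by `Ker(H ↠ H_A) = H ∩ Gal(K̄/L)`: the Kummer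
cocycle of `α` on `H` (transported to `μ_N(A)`-coefficients by `muCoeffIso`) is inflated from `H_A`,
hence vanishes on the kernel. [cite: MochizukiFrdII2008, Rmk 2.2.1 p.18] -/
theorem smul_eq_of_isNHSaturated (m : MuModel L O N) (h : IsNHSaturated (ofGalois L H hH res res_smul) N)
    (α : (AlgebraicClosure K)ˣ) (hα : ∀ σ : absoluteGaloisGroup K, σ ∈ H → σ • α ^ N = α ^ N)
    (σ : absoluteGaloisGroup K) (hσH : σ ∈ H) (hσL : resGal L σ = 1) : σ • α = α := by
  -- the cocycle with `μ_N(K̄)` coefficients and its transport to `μ_N(A)` coefficients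
  let cB := kummerCocycleOn H N α hα
  let e := muCoeffIso L O H hH res res_smul m
  let cA := contOneCocycles.pullback (ContinuousMonoidHom.id H) (resIdHom e.inv) cB
  -- (c): the class of `cA` is inflated from `H_A`, hence `cA` vanishes at `σ` (instances of the
  -- abstract lemma are taken from the types of `qHA`, not re-synthesised; see the header of
  -- `PadicKummerGaloisFN.lean`)
  have hq : (ofGalois L H hH res res_smul).qHA ⟨σ, hσH⟩ = 1 := Subtype.ext hσL
  have h0 : cA.1 ⟨σ, hσH⟩ = 0 :=
    oneCocycle_apply_eq_zero_of_isNHSaturated (ofGalois L H hH res res_smul) N h cA hq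
  -- and so does `cB`
  have h0' : cB.1 ⟨σ, hσH⟩ = 0 := by
    rw [contOneCocycles.pullback_apply, resIdHom_hom_apply] at h0
    have hinj : Function.Injective e.inv.hom := fun a b hab => by
      have := congrArg e.hom.hom hab
      rwa [← TopRep.comp_apply, ← TopRep.comp_apply, e.inv_hom_id, TopRep.id_apply,
        TopRep.id_apply] at this
    exact hinj (h0.trans (map_zero e.inv.hom).symm)
  have h1 := congrArg (muVal K N) h0'
  rw [muVal_kummerCocycleOn, muVal_zero, div_eq_one] at h1
  exact h1

end Fixed

/-! ### Remark 2.2.1: the natural isomorphism `O^□(A)^H ⥲ O^□(L^H)` -/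

section Invariants

variable {K : Type} [Field K] (L : IntermediateField K (AlgebraicClosure K))
  [Normal K L] [FiniteDimensional K L]
  (H : Subgroup (absoluteGaloisGroup K)) [H.Normal] (hH : IsOpen (H : Set (absoluteGaloisGroup K)))
  (S : StableSubmonoid L)

/-- `L^H`: "the subfield of elements [of `L`] on which `H_A` acts trivially" (FrdII Rmk. 2.2.1 p. 18),
for the arithmetic context — the fixed field of `H_A ≤ Gal(L/K)` in `L`.
[cite: MochizukiFrdII2008, Rmk 2.2.1 p.18] -/
def invariantField : IntermediateField K L := fixedField (ofLocalField L H hH S).HA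

/-- `O^□(L^H)`: the elements of `L^H` lying in `O^□_L` (for `O^□ = O^⊳` these are exactly the
nonzero `𝒪_K`-integral elements of `L^H`, `submonoidOfInvariantField_tri`).
[cite: MochizukiFrdII2008, Rmk 2.2.1 p.18] -/
def submonoidOfInvariantField : Submonoid (invariantField L H hH S) where
  carrier := {x | ((x : L) : L) ∈ S.toSubmonoid}
  one_mem' := S.toSubmonoid.one_mem
  mul_mem' hx hy := S.toSubmonoid.mul_mem hx hy

/-- **Remark 2.2.1** (FrdII p. 18): "we have a natural isomorphism `(O^□(A) ⊇) O^□(A)^H ⥲ O^□(L^H)`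
[where the superscript `H`'s denote the submonoids/subfields of elements on which `H_A` acts
trivially]" — at the arithmetic context, the identity on underlying elements of `L`.
[cite: MochizukiFrdII2008, Rmk 2.2.1 p.18] -/
def invariantsEquiv :
    Kummer.invariantsSubmonoid (GalMonoid S) (ofLocalField L H hH S).HA ≃*
      submonoidOfInvariantField L H hH S where
  toFun f := ⟨⟨(f : GalMonoid S).val, (mem_fixedField_iff _ _).mpr fun τ hτ => by
      have h := f.2 ⟨τ, hτ⟩
      rw [GalMonoid.ext_iff, GalMonoid.val_smul, AlgEquiv.smul_def] at h
      exact h⟩, (f : GalMonoid S).val_mem⟩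
  invFun y := ⟨GalMonoid.mk ((y : invariantField L H hH S) : L) y.2, fun τ =>
      GalMonoid.ext (by
        rw [GalMonoid.val_smul, GalMonoid.val_mk, AlgEquiv.smul_def]
        exact (mem_fixedField_iff _ _).mp (y : invariantField L H hH S).2 _ τ.2)⟩
  left_inv f := Subtype.ext (GalMonoid.ext rfl)
  right_inv y := rfl
  map_mul' _ _ := rfl

/-- The isomorphism is the identity on `L`. [cite: MochizukiFrdII2008, Rmk 2.2.1 p.18] -/
@[simp] theorem coe_invariantsEquiv (f : Kummer.invariantsSubmonoid (GalMonoid S) (ofLocalField L H hH S).HA) :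
    (((invariantsEquiv L H hH S f : submonoidOfInvariantField L H hH S) : invariantField L H hH S) : L) =
      (f : GalMonoid S).val :=
  rfl

variable (K) [ValuativeRel K]

/-- For `O^□ = O^⊳`: `O^⊳(L^H)` is abc-iut-L4-t2's `nonzeroIntegers K (L^H)` — the nonzero elements
of `L^H` integral over `𝒪_K` (integrality is insensitive to the ambient field).
[cite: MochizukiFrdII2008, Rmk 2.2.1 p.18] -/
theorem mem_submonoidOfInvariantField_tri_iff (x : invariantField L H hH (triSubmonoid K L)) :
    x ∈ submonoidOfInvariantField L H hH (triSubmonoid K L) ↔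
      x ∈ Literature.AnabelianGeometry.AbsoluteAnabelian.nonzeroIntegers K
        (invariantField L H hH (triSubmonoid K L)) := by
  let ι : invariantField L H hH (triSubmonoid K L) →ₐ[𝒪[K]] L :=
    (invariantField L H hH (triSubmonoid K L)).val.restrictScalars 𝒪[K]
  have hinj : Function.Injective ι := (invariantField L H hH (triSubmonoid K L)).val.toRingHom.injective
  change (IsIntegral 𝒪[K] (ι x) ∧ (x : L) ≠ 0) ↔ (IsIntegral 𝒪[K] x ∧ x ≠ 0)
  exact and_congr (isIntegral_algHom_iff ι hinj) (not_congr ZeroMemClass.coe_eq_zero)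

end Invariants

/-! ### Remark 2.2.1 at the arithmetic context -/

/-- `val` commutes with powers. [cite: MochizukiFrdII2008, Rmk 2.2.1 p.18] -/
@[simp] theorem _root_.Literature.AlgebraicGeometry.Frobenioids.PadicKummer.GalMonoid.val_pow
    {K : Type} [Field K] {L : IntermediateField K (AlgebraicClosure K)} {S : StableSubmonoid L}
    (x : GalMonoid S) (n : ℕ) : (x ^ n).val = x.val ^ n := by
  induction n with
  | zero => rw [pow_zero, pow_zero, GalMonoid.val_one]
  | succ n ih => rw [pow_succ, pow_succ, GalMonoid.val_mul, ih]

section Roots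

variable {K : Type} [Field K] [CharZero K] (L : IntermediateField K (AlgebraicClosure K))
  [Normal K L] [FiniteDimensional K L]
  (H : Subgroup (absoluteGaloisGroup K)) [H.Normal] (hH : IsOpen (H : Set (absoluteGaloisGroup K)))
  (S : StableSubmonoid L) (N : ℕ) [NeZero N]

omit [CharZero K] [NeZero N] in
/-- An `H_A`-invariant element of `O^□_L` is fixed, inside `K̄`, by every `σ ∈ H`.
[cite: MochizukiFrdII2008, Rmk 2.2.1 p.18] -/
theorem smul_coe_eq_of_mem_invariants {f : GalMonoid S}
    (hf : f ∈ Kummer.invariantsSubmonoid (GalMonoid S) (ofLocalField L H hH S).HA)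
    {σ : absoluteGaloisGroup K} (hσ : σ ∈ H) :
    σ • ((f.val : L) : AlgebraicClosure K) = ((f.val : L) : AlgebraicClosure K) := by
  have h := (mem_invariantsSubmonoid_ofLocalField_iff L H hH S f).mp hf σ hσ
  rw [← coe_resGal_apply, ← AlgEquiv.smul_def, h]

omit [Normal K L] [FiniteDimensional K L] in
/-- `K̄^{Gal(K̄/L)} = L` (the Galois correspondence for `K̄/K`, `K` of characteristic `0`):
an element of `K̄` fixed by `Gal(K̄/L)` lies in `L`. [cite: MochizukiFrdII2008, Rmk 2.2.1 p.18] -/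
theorem mem_of_forall_galFixing_smul_eq {x : AlgebraicClosure K}
    (hx : ∀ σ : absoluteGaloisGroup K, σ ∈ galFixing K L → σ • x = x) : x ∈ L := by
  rw [← InfiniteGalois.fixedField_fixingSubgroup L, IntermediateField.mem_fixedField_iff]
  intro g hg
  exact hx ((absoluteGaloisGroup.toAlgEquiv K).symm g) hg

omit [Normal K L] [FiniteDimensional K L] in
/-- **Definition 2.1 (i) ⇒ `μ_N(K̄) ⊆ L`**: if `O^□_L` is `μ_N`-saturated ("the abstract group
`μ_N(A)` is isomorphic to `ℤ/Nℤ`"), then all `N` `N`-th roots of unity of `K̄` lie in `L` — the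
injection `μ_N(O^□_L) ↪ μ_N(K̄)` (`MuModel.muHomOfMonoidHom` along `O^□_L ⊆ K̄`) is a bijection by
counting (`K` of characteristic `0`). [cite: MochizukiFrdII2008, Def 2.1 (i) p.16] -/
theorem coe_rootsOfUnity_mem_of_isMuSaturated (h : Kummer.IsMuSaturated N (GalMonoid S))
    (ζ : rootsOfUnity N (AlgebraicClosure K)) :
    ((ζ : (AlgebraicClosure K)ˣ) : AlgebraicClosure K) ∈ L := by
  obtain ⟨e⟩ := h.nonempty_mulEquiv
  have hcardMu : Nat.card (Kummer.Mu N (GalMonoid S)) = N := by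
    rw [Nat.card_congr (e.toEquiv.trans Multiplicative.toAdd), Nat.card_zmod]
  haveI : NeZero (N : K) := ⟨Nat.cast_ne_zero.2 (NeZero.ne N)⟩
  have hcardR : Nat.card (rootsOfUnity N (AlgebraicClosure K)) = N :=
    HasEnoughRootsOfUnity.natCard_rootsOfUnity (AlgebraicClosure K) N
  have hinj := MuModel.muHomOfMonoidHom_injective (N := N) (GalMonoid.toClosure S)
    (GalMonoid.toClosure_injective S)
  have hbij := hinj.bijective_of_nat_card_le (by rw [hcardR, hcardMu])
  obtain ⟨u, hu⟩ := hbij.2 ζ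
  rw [← hu, MuModel.coe_muHomOfMonoidHom, GalMonoid.toClosure_apply]
  exact SetLike.coe_mem _

/-- **Remark 2.2.1 DISCHARGED at the arithmetic context** (FrdII p. 18: "any element
`f ∈ O^□(A)^H` admits an `N`-th root `g ∈ O^□(A) — i.e., g^N = f`"): for `K` of characteristic
`0`, `L ⊆ K̄` finite Galois with `Gal(K̄/L) ≤ H`, and `O^□_L` closed under `N`-th roots in `L`
(e.g. `O^⊳_L`, `O^×_L`), the named fact `SaturatedInvariantsAdmitRoots` holds for
`Def22Context.ofLocalField L H hH S`: an `(N, H)`-saturated `A` has `O^□(A)^H ⊆ (O^□(A))^N`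
((a) supplies `μ_N(K̄) ⊆ L`, (c) the descent). [cite: MochizukiFrdII2008, Rmk 2.2.1 p.18] -/
theorem saturatedInvariantsAdmitRoots_ofLocalField (hHL : galFixing K L ≤ H)
    (hS : ∀ x : L, x ^ N ∈ S.toSubmonoid → x ∈ S.toSubmonoid) :
    SaturatedInvariantsAdmitRoots (ofLocalField L H hH S) N := by
  intro hsat f hf
  have hN : 0 < N := NeZero.pos N
  -- (a) `μ_N`-saturation ⇒ `μ_N(K̄) ⊆ L`
  have hμ := coe_rootsOfUnity_mem_of_isMuSaturated L S N hsat.muSaturated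
  -- an `N`-th root `α` of `f` in `K̄`
  have hf0 : ((f.val : L) : AlgebraicClosure K) ≠ 0 := by
    rw [Ne, ZeroMemClass.coe_eq_zero]
    exact GalMonoid.val_ne_zero f
  obtain ⟨α, hαN⟩ := IsAlgClosed.exists_pow_nat_eq ((f.val : L) : AlgebraicClosure K) hN
  have hα0 : α ≠ 0 := fun h => hf0 (by rw [← hαN, h, zero_pow hN.ne'])
  let αu : (AlgebraicClosure K)ˣ := Units.mk0 α hα0
  have hαu : ∀ σ : absoluteGaloisGroup K, σ ∈ H → σ • αu ^ N = αu ^ N := fun σ hσ => by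
    apply Units.ext
    rw [Units.coe_smul, Units.val_pow_eq_pow_val, Units.val_mk0, hαN]
    exact smul_coe_eq_of_mem_invariants L H hH S hf hσ
  -- (c) ⇒ `α` is fixed by `Gal(K̄/L)` (`≤ H`), hence lies in `L`
  have hS1 : ∀ x : L, x ^ N = 1 → x ∈ S.toSubmonoid := fun x hx =>
    hS x (by rw [hx]; exact S.toSubmonoid.one_mem)
  have hfix : ∀ σ : absoluteGaloisGroup K, σ ∈ galFixing K L → σ • α = α := fun σ hσ => by
    have h := smul_eq_of_isNHSaturated L H hH (GalMonoid S) (MonoidHom.id _) (fun _ _ => rfl)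
      (muModelOfSubmonoid L S N hS1 hN hμ) hsat αu hαu σ (hHL hσ)
      (by rw [← MonoidHom.mem_ker, ker_resGal]; exact hσ)
    have h' := congrArg (fun u : (AlgebraicClosure K)ˣ => (u : AlgebraicClosure K)) h
    simpa only [Units.coe_smul, αu, Units.val_mk0] using h'
  have hαL : α ∈ L := mem_of_forall_galFixing_smul_eq L hfix
  -- the root `g := α ∈ O^□_L`
  have hgN : (⟨α, hαL⟩ : L) ^ N = f.val := Subtype.ext hαN
  have hgS : (⟨α, hαL⟩ : L) ∈ S.toSubmonoid := hS _ (by rw [hgN]; exact f.val_mem)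
  refine ⟨GalMonoid.mk ⟨α, hαL⟩ hgS, GalMonoid.ext ?_⟩
  rw [GalMonoid.val_pow, GalMonoid.val_mk, hgN]

end Roots

end Def22Context

end PadicKummer

end Literature.AlgebraicGeometry.Frobenioids

end
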